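import Literature.Analysis.FluidPDE.CLStressAlgebra
import Literature.Analysis.FluidPDE.CLEstimateTools
import HarnessLib

/-!
# Cheskidov–Luo convex integration: the constants of the estimates (CL22 §5, "`C_u`" and "`≲`")

Analysis/FluidPDE support file for the proof of Prop. 4.1 of A. Cheskidov, X. Luo, *Sharp
nonuniqueness for the Navier–Stokes equations*, Invent. Math. 229 (2022) = arXiv:2009.06596, §5
(numbering of the held arXiv copy). §5 opens with: "we use a constant `C_u` for dependency on the
previous solution `(ū, R̄)` throughout this section", and every bound of Lemma 5.2,
Props. 5.3–5.5 and Lemmas 5.6–5.8 has the shape `C_u × (explicit power of the parameters)`.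
For the explicit perturbation `D.w` of `CLPerturbation` (data `D : CL22.Datum d`: horizon `T`,
floor `γ₀`, old stress `R`, cut-off `θ`, bumps `g_x`, parameters `ν, κ, μ, σ`) this file
isolates the two kinds of constants and PROVES their existence:

* `CL22.Datum.DataBounds D A` — ONE number `A` dominating, on `[0, T] × 𝕋^d`, every
  PARAMETER-FREE quantity entering the estimates: the bumps `g_x`, `g_x'`, the cut-off
  derivative `θ'`, the amplitudes `ã_x = θ â_x` with their space/time derivatives
  (`∇ã_x`, `∇∇ã_x`, `∂ₜã_x`, `∂ₜ∇ã_x`, `Δ(ã_x²)`, `(k_x·∇)ã_x`, `(k_x·∇)ã_x²` and their gradients),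
  and the Helmholtz-projected fields `Z_x = 𝒫 div B̂_x` with `∇Z_x`, `∂ₜZ_x` (CL22 Lemma 5.2:
  "`‖∂ₜⁿ∇ᵐ a_k‖ ≤ C_{u,m,n} …`"; Prop. 5.5: "`‖w^{(t)}‖_{L^∞W^{1,∞}} ≤ C_u ν⁻¹`"). None of these
  objects involves `ν, κ, μ, σ` (`D.atil`, `D.gradA`, `D.Z` only see `T, γ₀, R, θ`), so `A` is a
  genuine `C_u`; existence (`exists_dataBounds`) is continuity on the compact `[0,T] × 𝕋^d`.
* `CL22.Datum.BlockConsts D C` — ONE number `C` for the SPATIAL BUILDING BLOCKS after the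
  rescaling `y ↦ σ • y`: sup and `L^p` (`1 ≤ p ≤ 2`) sizes of `ψ_x(σ·)`, `∇[ψ_x(σ·)]`,
  `∇P_x = σ⁻¹(∇φ_x)(σ·)`, `∇∇P_x`, `∇Φ^B_{x,j} = σ⁻²(∇∂ⱼΘ_x)(σ·)`, and the `L²` sizes of
  `∇Φ^C_x = σ⁻¹(∇Δ⁻¹(ψ_x²-1))(σ·)` and of `Δ⁻¹(ψ_x² - 1)`, each as `C ×` the power of `μ`, `σ`
  printed in CL22 Thm. 4.3 (2) (`μ^{-m}‖∇ᵐ𝐖_k‖_p ≲ μ^{(d-1)(1/2-1/p)}`, `‖∇ᵐΩ_k‖_p` one power of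
  `μ` lower). Here `C` depends on the dimension only (`exists_blockConsts`: the `IsConc` bounds of
  `MikadoRescaled`, uniformised over the finitely many directions and coordinates).
* the time factors: `∫₀ᵀ|G_x| ≤ (T+1)κ^{-1/2}A`, `∫₀ᵀ|G_x|^p ≤ (T+1)κ^{p/2-1}A^p`, `∫₀ᵀ G_x² ≤ T+1`,
  `|G_x| ≤ κ^{1/2}A`, `∫₀ᵀ|G_x'| ≤ (T+1)νκ^{1/2}A`, `|H_x| ≤ ν⁻¹` (CL22 (4.10)–(4.12)).

Everything is proved; the two structures are mere conjunctions of inequalities (no data).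

## References

* A. Cheskidov, X. Luo, arXiv:2009.06596, §4.1 Thm. 4.3, §4.2 (4.10)–(4.12), §5 (first
  paragraph), Lemma 5.2, Props. 5.3–5.5. [`CheskidovLuo2022`]
-/

noncomputable section

open Set Filter Topology Function MeasureTheory Finset
open scoped ContDiff ENNReal

namespace Literature.Analysis.FluidPDE

namespace CL22

open FunctionSpaces NashGeometric Mikado Intermittent

variable {d : Type*} [Fintype d] [DecidableEq d]

/-! ## Uniform constants over finite index types -/

omit [Fintype d] [DecidableEq d] in
/-- From one constant per index to a single constant, for predicates monotone in the constant
and a finite index type. [folklore] -/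
theorem exists_forall_of_fintype {ι : Type*} [Fintype ι] {P : ι → ℝ → Prop}
    (hmono : ∀ i C C', C ≤ C' → P i C → P i C') (h : ∀ i, ∃ C, 0 ≤ C ∧ P i C) :
    ∃ C, 0 ≤ C ∧ ∀ i, P i C := by
  classical
  choose C hC0 hC using h
  refine ⟨∑ i, C i, Finset.sum_nonneg fun i _ => hC0 i, fun i => hmono i _ _ ?_ (hC i)⟩
  exact Finset.single_le_sum (fun j _ => hC0 j) (Finset.mem_univ i)

variable (d) in
/-- The concentration exponent `a_d = (d-1)/2` of the pipe profile `ψ_x` (CL22 (4.5):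
`ψ_k = μ^{(d-1)/2} ψ(μ dist(l_k, x))`). [cite: CheskidovLuo2022, §4.1 (4.5)] -/
def aexp : ℝ := ((Fintype.card d : ℝ) - 1) / 2

namespace Datum

variable (D : Datum d)

/-! ## The parameter-free bounds `A` ("`C_u`") -/

/-- **The parameter-free bounds.** One number `A ≥ 0` dominating on `[0, T] × 𝕋^d` all the
quantities of the construction that do not involve the parameters `ν, κ, μ, σ`: the bumps and
their derivatives, `θ'`, the amplitudes `ã_x` with the derivatives used in §5, and the fields
`Z_x` of the temporal corrector with `∇Z_x`, `∂ₜZ_x` (CL22 §5: "a constant `C_u` for dependency on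
the previous solution"; Lemma 5.2). [cite: CheskidovLuo2022, §5.2 Lemma 5.2] -/
structure DataBounds (A : ℝ) : Prop where
  nonneg : 0 ≤ A
  g_le : ∀ x s, |D.g x s| ≤ A
  dg_le : ∀ x s, |deriv (D.g x) s| ≤ A
  dθ_le : ∀ t ∈ Icc 0 D.T, |deriv D.θ t| ≤ A
  atil_le : ∀ x, ∀ t ∈ Icc 0 D.T, ∀ y, |D.atil x t y| ≤ A
  gradA_le : ∀ x, ∀ t ∈ Icc 0 D.T, ∀ y, ‖D.gradA x t y‖ ≤ A
  dgradA_le : ∀ x (i : d), ∀ t ∈ Icc 0 D.T, ∀ y, ‖Torus.partialDeriv i (D.gradA x t) y‖ ≤ A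
  dtatil_le : ∀ x, ∀ t ∈ Icc 0 D.T, ∀ y, |Torus.timeDerivWithin (Icc 0 D.T) (D.atil x) t y| ≤ A
  dtgradA_le : ∀ x, ∀ t ∈ Icc 0 D.T, ∀ y, ‖Torus.timeDerivWithin (Icc 0 D.T) (D.gradA x) t y‖ ≤ A
  lap_atilSq_le : ∀ x, ∀ t ∈ Icc 0 D.T, ∀ y, |Torus.laplacian (fun z => D.atil x t z ^ 2) y| ≤ A
  dt_atilSq_le : ∀ x, ∀ t ∈ Icc 0 D.T, ∀ y,
    |Torus.timeDerivWithin (Icc 0 D.T) (fun s z => D.atil x s z ^ 2) t y| ≤ A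
  dirD_atil_le : ∀ x, ∀ t ∈ Icc 0 D.T, ∀ y, |dirD x (D.atil x t) y| ≤ A
  d_dirD_atil_le : ∀ x (l : d), ∀ t ∈ Icc 0 D.T, ∀ y, |Torus.partialDeriv l (dirD x (D.atil x t)) y| ≤ A
  dirD_atilSq_le : ∀ x, ∀ t ∈ Icc 0 D.T, ∀ y, |dirD x (fun z => D.atil x t z ^ 2) y| ≤ A
  d_dirD_atilSq_le : ∀ x (l : d), ∀ t ∈ Icc 0 D.T, ∀ y,
    |Torus.partialDeriv l (dirD x fun z => D.atil x t z ^ 2) y| ≤ A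
  Z_le : ∀ x, ∀ t ∈ Icc 0 D.T, ∀ y, ‖D.Z x t y‖ ≤ A
  dZ_le : ∀ x (i : d), ∀ t ∈ Icc 0 D.T, ∀ y, ‖Torus.partialDeriv i (D.Z x t) y‖ ≤ A
  dtZ_le : ∀ x, ∀ t ∈ Icc 0 D.T, ∀ y, ‖Torus.timeDerivWithin (Icc 0 D.T) (D.Z x) t y‖ ≤ A

/-! ## The block constants `C` ("`≲`", depending on the dimension only) -/

/-- **The block constants.** One number `C ≥ 0` controlling the sup and `L^p` (`1 ≤ p ≤ 2`) sizes
of the rescaled spatial building blocks in terms of the printed powers of `μ` and `σ`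
(CL22 Thm. 4.3 (2), with `a = (d-1)/2`): `ψ_x(σ·)` (order `a`), `∇[ψ_x(σ·)] = σ(∇ψ_x)(σ·)`
(order `a+1`, factor `σ`), `∇P_x = σ⁻¹(∇φ_x)(σ·)` (order `a-1`, factor `σ⁻¹`), `∇∇P_x` (order `a`),
`∇Φ^B_{x,j} = σ⁻²(∇∂ⱼΘ_x)(σ·)` (order `a-2`, factor `σ⁻²`), and in `L²`: `∇Φ^C_x` (`σ⁻¹ μ^a`) and
`Δ⁻¹(ψ_x² - 1)` (`μ^a`). [cite: CheskidovLuo2022, §4.1 Thm. 4.3 (2)] -/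
structure BlockConsts (C : ℝ) : Prop where
  nonneg : 0 ≤ C
  Ψ_sup : ∀ x y, |D.Ψ x y| ≤ C * D.μ ^ aexp d
  Ψ_Lp : ∀ x (p : ℝ), 1 ≤ p → p ≤ 2 →
    eLpNorm (D.Ψ x) (ENNReal.ofReal p) volume ≤ ENNReal.ofReal (C * D.μ ^ (aexp d - ((Fintype.card d : ℝ) - 1) / p))
  dΨ_Lp : ∀ x (l : d) (p : ℝ), 1 ≤ p → p ≤ 2 →
    eLpNorm (Torus.partialDeriv l (D.Ψ x)) (ENNReal.ofReal p) volume ≤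
      ENNReal.ofReal (C * D.σ * D.μ ^ (aexp d + 1 - ((Fintype.card d : ℝ) - 1) / p))
  dP_sup : ∀ x (l : d) y, |Torus.partialDeriv l (D.P x) y| ≤ C * (D.σ : ℝ)⁻¹ * D.μ ^ (aexp d - 1)
  dP_Lp : ∀ x (l : d) (p : ℝ), 1 ≤ p → p ≤ 2 →
    eLpNorm (Torus.partialDeriv l (D.P x)) (ENNReal.ofReal p) volume ≤
      ENNReal.ofReal (C * (D.σ : ℝ)⁻¹ * D.μ ^ (aexp d - 1 - ((Fintype.card d : ℝ) - 1) / p))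
  ddP_sup : ∀ x (i l : d) y, |Torus.partialDeriv i (Torus.partialDeriv l (D.P x)) y| ≤ C * D.μ ^ aexp d
  ddP_Lp : ∀ x (i l : d) (p : ℝ), 1 ≤ p → p ≤ 2 →
    eLpNorm (Torus.partialDeriv i (Torus.partialDeriv l (D.P x))) (ENNReal.ofReal p) volume ≤
      ENNReal.ofReal (C * D.μ ^ (aexp d - ((Fintype.card d : ℝ) - 1) / p))
  dΦB_sup : ∀ x (j l : d) y, |Torus.partialDeriv l (D.ΦB x j) y| ≤ C * ((D.σ : ℝ) ^ 2)⁻¹ * D.μ ^ (aexp d - 2)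
  dΦB_Lp : ∀ x (j l : d) (p : ℝ), 1 ≤ p → p ≤ 2 →
    eLpNorm (Torus.partialDeriv l (D.ΦB x j)) (ENNReal.ofReal p) volume ≤
      ENNReal.ofReal (C * ((D.σ : ℝ) ^ 2)⁻¹ * D.μ ^ (aexp d - 2 - ((Fintype.card d : ℝ) - 1) / p))
  dΦC_L2 : ∀ x (l : d), eLpNorm (Torus.partialDeriv l (D.ΦC x)) 2 volume ≤
      ENNReal.ofReal (C * (D.σ : ℝ)⁻¹ * D.μ ^ aexp d)
  invLap_fluct_L2 : ∀ x : Index d, Real.sqrt (∫ y, Torus.invLaplacian (fluct x D.μ) y ^ 2) ≤ C * D.μ ^ aexp d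

/-! ## Existence of the parameter-free bounds -/

section DataBoundsExist

variable {D}

omit [DecidableEq d] in
/-- A jointly smooth real field on `[0,T]` is bounded there, uniformly over a finite family. [folklore] -/
theorem exists_abs_le_of_smooth {ι : Type*} [Fintype ι] {f : ι → ℝ → UnitAddTorus d → ℝ}
    (hf : ∀ i, Torus.IsSmoothSpaceTimeOn (Icc 0 D.T) (f i)) :
    ∃ C, 0 ≤ C ∧ ∀ i, ∀ t ∈ Icc 0 D.T, ∀ y, |f i t y| ≤ C := by
  refine exists_forall_of_fintype (P := fun i C => ∀ t ∈ Icc 0 D.T, ∀ y, |f i t y| ≤ C)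
    (fun i C C' hCC' hC t ht y => (hC t ht y).trans hCC') fun i => ?_
  obtain ⟨C, hC⟩ := (hf i).exists_norm_le_of_isCompact isCompact_Icc subset_rfl
  exact ⟨max C 0, le_max_right _ _, fun t ht y => ((Real.norm_eq_abs _).symm.le.trans (hC t ht y)).trans (le_max_left _ _)⟩

omit [DecidableEq d] in
/-- A jointly smooth vector field on `[0,T]` is bounded there, uniformly over a finite family. [folklore] -/
theorem exists_norm_le_of_smooth {ι : Type*} [Fintype ι] {F : Type*} [NormedAddCommGroup F] [NormedSpace ℝ F]
    {f : ι → ℝ → UnitAddTorus d → F} (hf : ∀ i, Torus.IsSmoothSpaceTimeOn (Icc 0 D.T) (f i)) :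
    ∃ C, 0 ≤ C ∧ ∀ i, ∀ t ∈ Icc 0 D.T, ∀ y, ‖f i t y‖ ≤ C := by
  refine exists_forall_of_fintype (P := fun i C => ∀ t ∈ Icc 0 D.T, ∀ y, ‖f i t y‖ ≤ C)
    (fun i C C' hCC' hC t ht y => (hC t ht y).trans hCC') fun i => ?_
  obtain ⟨C, hC⟩ := (hf i).exists_norm_le_of_isCompact isCompact_Icc subset_rfl
  exact ⟨max C 0, le_max_right _ _, fun t ht y => (hC t ht y).trans (le_max_left _ _)⟩

variable (h : D.Valid)
include h

/-- `ã_x²` is jointly smooth. [folklore] -/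
theorem smooth_atilSq (x : Index d) : Torus.IsSmoothSpaceTimeOn (Icc 0 D.T) (fun t z => D.atil x t z ^ 2) := by
  have := (smooth_atil h x).mul (smooth_atil h x)
  simpa [sq] using this

/-- **Existence of the parameter-free bounds** (continuity on the compact `[0,T] × 𝕋^d`, and
boundedness of bumps). [cite: CheskidovLuo2022, §5.2 Lemma 5.2] -/
theorem exists_dataBounds : ∃ A, D.DataBounds A := by
  have hU := uniqueDiffOn h
  -- bumps
  obtain ⟨B₁, hB₁0, hB₁⟩ : ∃ B, 0 ≤ B ∧ ∀ x s, |D.g x s| ≤ B := by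
    refine exists_forall_of_fintype (P := fun x B => ∀ s, |D.g x s| ≤ B)
      (fun x C C' hCC' hC s => (hC s).trans hCC') fun x => ?_
    obtain ⟨B, hB0, hB⟩ := (h.hg x).exists_bound
    exact ⟨B, hB0, hB⟩
  obtain ⟨B₂, hB₂0, hB₂⟩ : ∃ B, 0 ≤ B ∧ ∀ x s, |deriv (D.g x) s| ≤ B := by
    refine exists_forall_of_fintype (P := fun x B => ∀ s, |deriv (D.g x) s| ≤ B)
      (fun x C C' hCC' hC s => (hC s).trans hCC') fun x => ?_
    obtain ⟨B, hB0, hB⟩ := (h.hg x).deriv.exists_bound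
    exact ⟨B, hB0, hB⟩
  -- `θ'` on `[0,T]`
  obtain ⟨B₃, hB₃⟩ : ∃ B, ∀ t ∈ Icc 0 D.T, |deriv D.θ t| ≤ B := by
    obtain ⟨B, hB⟩ := isCompact_Icc.exists_bound_of_continuousOn
      ((h.hθ.continuous_deriv (by simp)).continuousOn (s := Icc 0 D.T))
    exact ⟨B, fun t ht => (Real.norm_eq_abs _).symm.le.trans (hB t ht)⟩
  -- amplitudes
  obtain ⟨C₁, hC₁0, hC₁⟩ := exists_abs_le_of_smooth (D := D) (f := fun x => D.atil x) (smooth_atil h)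
  obtain ⟨C₂, hC₂0, hC₂⟩ := exists_norm_le_of_smooth (D := D) (f := fun x => D.gradA x) (smooth_gradA h)
  obtain ⟨C₃, hC₃0, hC₃⟩ := exists_norm_le_of_smooth (D := D)
    (f := fun (q : Index d × d) t => Torus.partialDeriv q.2 (D.gradA q.1 t)) fun q => (smooth_gradA h q.1).partialDeriv hU q.2
  obtain ⟨C₄, hC₄0, hC₄⟩ := exists_abs_le_of_smooth (D := D)
    (f := fun x => Torus.timeDerivWithin (Icc 0 D.T) (D.atil x)) fun x => (smooth_atil h x).timeDerivWithin hU
  obtain ⟨C₅, hC₅0, hC₅⟩ := exists_norm_le_of_smooth (D := D)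
    (f := fun x => Torus.timeDerivWithin (Icc 0 D.T) (D.gradA x)) fun x => (smooth_gradA h x).timeDerivWithin hU
  obtain ⟨C₆, hC₆0, hC₆⟩ := exists_abs_le_of_smooth (D := D)
    (f := fun x t => Torus.laplacian (fun z => D.atil x t z ^ 2)) fun x => (smooth_atilSq h x).laplacian hU
  obtain ⟨C₇, hC₇0, hC₇⟩ := exists_abs_le_of_smooth (D := D)
    (f := fun x => Torus.timeDerivWithin (Icc 0 D.T) (fun s z => D.atil x s z ^ 2)) fun x => (smooth_atilSq h x).timeDerivWithin hU
  obtain ⟨C₈, hC₈0, hC₈⟩ := exists_abs_le_of_smooth (D := D)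
    (f := fun x t => dirD x (D.atil x t)) fun x => smooth_dirD h x (smooth_atil h x)
  obtain ⟨C₉, hC₉0, hC₉⟩ := exists_abs_le_of_smooth (D := D)
    (f := fun (q : Index d × d) t => Torus.partialDeriv q.2 (dirD q.1 (D.atil q.1 t)))
    fun q => (smooth_dirD h q.1 (smooth_atil h q.1)).partialDeriv hU q.2
  obtain ⟨C₁₀, hC₁₀0, hC₁₀⟩ := exists_abs_le_of_smooth (D := D)
    (f := fun x t => dirD x (fun z => D.atil x t z ^ 2)) fun x => smooth_dirD h x (smooth_atilSq h x)
  obtain ⟨C₁₁, hC₁₁0, hC₁₁⟩ := exists_abs_le_of_smooth (D := D)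
    (f := fun (q : Index d × d) t => Torus.partialDeriv q.2 (dirD q.1 fun z => D.atil q.1 t z ^ 2))
    fun q => (smooth_dirD h q.1 (smooth_atilSq h q.1)).partialDeriv hU q.2
  obtain ⟨C₁₂, hC₁₂0, hC₁₂⟩ := exists_norm_le_of_smooth (D := D) (f := fun x => D.Z x) (smooth_Z h)
  obtain ⟨C₁₃, hC₁₃0, hC₁₃⟩ := exists_norm_le_of_smooth (D := D)
    (f := fun (q : Index d × d) t => Torus.partialDeriv q.2 (D.Z q.1 t)) fun q => (smooth_Z h q.1).partialDeriv hU q.2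
  obtain ⟨C₁₄, hC₁₄0, hC₁₄⟩ := exists_norm_le_of_smooth (D := D)
    (f := fun x => Torus.timeDerivWithin (Icc 0 D.T) (D.Z x)) fun x => (smooth_Z h x).timeDerivWithin hU
  set A : ℝ := B₁ + B₂ + |B₃| + C₁ + C₂ + C₃ + C₄ + C₅ + C₆ + C₇ + C₈ + C₉ + C₁₀ + C₁₁ + C₁₂ + C₁₃ + C₁₄ with hA
  have hB₃' : B₃ ≤ |B₃| := le_abs_self _
  have h3 : 0 ≤ |B₃| := abs_nonneg _
  refine ⟨A, ⟨by positivity, ?_, ?_, ?_, ?_, ?_, ?_, ?_, ?_, ?_, ?_, ?_, ?_, ?_, ?_, ?_, ?_, ?_⟩⟩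
  · intro x s; exact (hB₁ x s).trans (by rw [hA]; linarith)
  · intro x s; exact (hB₂ x s).trans (by rw [hA]; linarith)
  · intro t ht; exact (hB₃ t ht).trans (by rw [hA]; linarith)
  · intro x t ht y; exact (hC₁ x t ht y).trans (by rw [hA]; linarith)
  · intro x t ht y; exact (hC₂ x t ht y).trans (by rw [hA]; linarith)
  · intro x i t ht y; exact (hC₃ (x, i) t ht y).trans (by rw [hA]; linarith)
  · intro x t ht y; exact (hC₄ x t ht y).trans (by rw [hA]; linarith)
  · intro x t ht y; exact (hC₅ x t ht y).trans (by rw [hA]; linarith)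
  · intro x t ht y; exact (hC₆ x t ht y).trans (by rw [hA]; linarith)
  · intro x t ht y; exact (hC₇ x t ht y).trans (by rw [hA]; linarith)
  · intro x t ht y; exact (hC₈ x t ht y).trans (by rw [hA]; linarith)
  · intro x l t ht y; exact (hC₉ (x, l) t ht y).trans (by rw [hA]; linarith)
  · intro x t ht y; exact (hC₁₀ x t ht y).trans (by rw [hA]; linarith)
  · intro x l t ht y; exact (hC₁₁ (x, l) t ht y).trans (by rw [hA]; linarith)
  · intro x t ht y; exact (hC₁₂ x t ht y).trans (by rw [hA]; linarith)
  · intro x i t ht y; exact (hC₁₃ (x, i) t ht y).trans (by rw [hA]; linarith)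
  · intro x t ht y; exact (hC₁₄ x t ht y).trans (by rw [hA]; linarith)

end DataBoundsExist

/-! ## Existence of the block constants -/

section BlockConstsExist

omit [DecidableEq d] in
/-- Uniform `IsConc` data over a finite family. [folklore] -/
theorem exists_isConc_uniform {ι : Type*} [Fintype ι] {a : ℝ} {P : ι → ℝ → UnitAddTorus d → ℝ}
    (hP : ∀ i, IsConc d a (P i)) :
    ∃ C, 0 ≤ C ∧ ∀ i μ, 1 ≤ μ → (∀ y, |P i μ y| ≤ C * μ ^ a) ∧
      ∀ p : ℝ, 1 ≤ p → p ≤ 2 →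
        eLpNorm (P i μ) (ENNReal.ofReal p) volume ≤ ENNReal.ofReal (C * μ ^ (a - ((Fintype.card d : ℝ) - 1) / p)) := by
  refine exists_forall_of_fintype
    (P := fun i C => ∀ μ, 1 ≤ μ → (∀ y, |P i μ y| ≤ C * μ ^ a) ∧ ∀ p : ℝ, 1 ≤ p → p ≤ 2 →
      eLpNorm (P i μ) (ENNReal.ofReal p) volume ≤ ENNReal.ofReal (C * μ ^ (a - ((Fintype.card d : ℝ) - 1) / p)))
    (fun i C C' hCC' hC μ hμ => ?_) fun i => ?_
  · have hμ0 : 0 ≤ μ := by linarith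
    refine ⟨fun y => ((hC μ hμ).1 y).trans (mul_le_mul_of_nonneg_right hCC' (Real.rpow_nonneg hμ0 _)),
      fun p hp hp2 => ((hC μ hμ).2 p hp hp2).trans (ENNReal.ofReal_le_ofReal ?_)⟩
    exact mul_le_mul_of_nonneg_right hCC' (Real.rpow_nonneg hμ0 _)
  · obtain ⟨-, C, hC0, hC⟩ := hP i
    exact ⟨C, hC0, hC⟩

/-- **Existence of the block constants, uniformly in the data** (the dimension fixed): there is
`C = C(d) ≥ 0` with `D.BlockConsts C` for every valid datum `D`. [cite: CheskidovLuo2022, §4.1 Thm. 4.3 (2)] -/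
theorem exists_blockConsts : ∃ C, 0 ≤ C ∧ ∀ D : Datum d, D.Valid → D.BlockConsts C := by
  -- the five concentrated families, uniformised over directions and coordinates
  obtain ⟨C₁, hC₁0, hC₁⟩ := exists_isConc_uniform (d := d) (ι := Index d) (fun x => isConc_psi (x := x))
  obtain ⟨C₂, hC₂0, hC₂⟩ := exists_isConc_uniform (d := d) (ι := Index d × d)
    (P := fun q μ => Torus.partialDeriv q.2 (psi q.1 μ)) fun q => isConc_partialDeriv_psi (x := q.1) q.2
  obtain ⟨C₃, hC₃0, hC₃⟩ := exists_isConc_uniform (d := d) (ι := Index d × d)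
    (P := fun q μ => Torus.partialDeriv q.2 (phi q.1 μ)) fun q => isConc_partialDeriv_phi (x := q.1) q.2
  obtain ⟨C₄, hC₄0, hC₄⟩ := exists_isConc_uniform (d := d) (ι := Index d × d × d)
    (P := fun q μ => Torus.partialDeriv q.2.1 (Torus.partialDeriv q.2.2 (phi q.1 μ)))
    fun q => isConc_partialDeriv_partialDeriv_phi (x := q.1) q.2.1 q.2.2
  obtain ⟨C₅, hC₅0, hC₅⟩ := exists_isConc_uniform (d := d) (ι := Index d × d × d)
    (P := fun q μ => Torus.partialDeriv q.2.1 (Torus.partialDeriv q.2.2 (theta q.1 μ)))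
    fun q => isConc_partialDeriv_partialDeriv_theta (x := q.1) q.2.1 q.2.2
  set C : ℝ := C₁ + C₂ + C₃ + C₄ + C₅ with hC
  have hle₁ : C₁ ≤ C := by rw [hC]; linarith
  have hle₂ : C₂ ≤ C := by rw [hC]; linarith
  have hle₃ : C₃ ≤ C := by rw [hC]; linarith
  have hle₄ : C₄ ≤ C := by rw [hC]; linarith
  have hle₅ : C₅ ≤ C := by rw [hC]; linarith
  have hC0 : 0 ≤ C := by positivity
  refine ⟨C, hC0, fun D h => ?_⟩
  have hμ := h.hμ
  have hμ0 : 0 ≤ D.μ := by linarith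
  have hσ := h.hσ
  have hσ' : (0 : ℝ) < D.σ := by exact_mod_cast hσ
  have hd := h.hd
  haveI : Nonempty d := Fintype.card_pos_iff.1 (by omega)
  -- generic upgrade of the constant
  have up : ∀ {C' : ℝ} {e : ℝ}, C' ≤ C → C' * D.μ ^ e ≤ C * D.μ ^ e := fun hC' =>
    mul_le_mul_of_nonneg_right hC' (Real.rpow_nonneg hμ0 _)
  have upE : ∀ {C' : ℝ} {e : ℝ}, C' ≤ C → ENNReal.ofReal (C' * D.μ ^ e) ≤ ENNReal.ofReal (C * D.μ ^ e) :=
    fun hC' => ENNReal.ofReal_le_ofReal (up hC')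
  have meas : ∀ {f : UnitAddTorus d → ℝ}, Continuous f → AEStronglyMeasurable f volume := fun hf => hf.aestronglyMeasurable
  refine ⟨hC0, ?_, ?_, ?_, ?_, ?_, ?_, ?_, ?_, ?_, ?_, ?_⟩
  · -- `Ψ` sup
    intro x y
    exact (((hC₁ x D.μ hμ).1 (D.σ • y))).trans (up hle₁)
  · -- `Ψ` in `L^p`
    intro x p hp hp2
    have e : D.Ψ x = fun y => psi x D.μ (D.σ • y) := rfl
    rw [e, eLpNorm_comp_nsmul (meas (isSmooth_psi x hμ).continuous) hσ]
    exact ((hC₁ x D.μ hμ).2 p hp hp2).trans (upE hle₁)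
  · -- `∂Ψ` in `L^p`
    intro x l p hp hp2
    have e : Torus.partialDeriv l (D.Ψ x) = fun y => (D.σ : ℝ) * Torus.partialDeriv l (psi x D.μ) (D.σ • y) :=
      funext fun y => partialDeriv_psiR x D.μ D.σ l y
    rw [e, show (fun y => (D.σ : ℝ) * Torus.partialDeriv l (psi x D.μ) (D.σ • y)) =
      (D.σ : ℝ) • fun y => Torus.partialDeriv l (psi x D.μ) (D.σ • y) from rfl, eLpNorm_const_smul,
      eLpNorm_comp_nsmul (meas ((isSmooth_psi x hμ).partialDeriv l).continuous) hσ, Real.enorm_eq_ofReal hσ'.le]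
    calc ENNReal.ofReal (D.σ : ℝ) * eLpNorm (Torus.partialDeriv l (psi x D.μ)) (ENNReal.ofReal p) volume
        ≤ ENNReal.ofReal (D.σ : ℝ) * ENNReal.ofReal (C * D.μ ^ (aexp d + 1 - ((Fintype.card d : ℝ) - 1) / p)) := by
          refine mul_le_mul' le_rfl (((hC₂ (x, l) D.μ hμ).2 p hp hp2).trans (upE hle₂ |>.trans_eq' ?_))
          simp [aexp]
      _ = ENNReal.ofReal (C * D.σ * D.μ ^ (aexp d + 1 - ((Fintype.card d : ℝ) - 1) / p)) := by
          rw [← ENNReal.ofReal_mul hσ'.le]; ring_nf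
  · -- `∂P` sup
    intro x l y
    rw [show D.P x = phiR x D.μ D.σ from rfl, partialDeriv_phiR x hμ hσ l y, abs_mul, abs_of_pos (inv_pos.2 hσ')]
    have h1 := (hC₃ (x, l) D.μ hμ).1 (D.σ • y)
    calc (D.σ : ℝ)⁻¹ * |Torus.partialDeriv l (phi x D.μ) (D.σ • y)|
        ≤ (D.σ : ℝ)⁻¹ * (C * D.μ ^ (aexp d - 1)) := by
          refine mul_le_mul_of_nonneg_left (h1.trans ((up hle₃).trans_eq' ?_)) (inv_pos.2 hσ').le
          simp [aexp]
      _ = C * (D.σ : ℝ)⁻¹ * D.μ ^ (aexp d - 1) := by ring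
  · -- `∂P` in `L^p`
    intro x l p hp hp2
    have e : Torus.partialDeriv l (D.P x) = fun y => (D.σ : ℝ)⁻¹ * Torus.partialDeriv l (phi x D.μ) (D.σ • y) :=
      funext fun y => partialDeriv_phiR x hμ hσ l y
    rw [e, show (fun y => (D.σ : ℝ)⁻¹ * Torus.partialDeriv l (phi x D.μ) (D.σ • y)) =
      (D.σ : ℝ)⁻¹ • fun y => Torus.partialDeriv l (phi x D.μ) (D.σ • y) from rfl, eLpNorm_const_smul,
      eLpNorm_comp_nsmul (meas ((isSmooth_phi x hμ).partialDeriv l).continuous) hσ,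
      Real.enorm_eq_ofReal (inv_pos.2 hσ').le]
    calc ENNReal.ofReal (D.σ : ℝ)⁻¹ * eLpNorm (Torus.partialDeriv l (phi x D.μ)) (ENNReal.ofReal p) volume
        ≤ ENNReal.ofReal (D.σ : ℝ)⁻¹ * ENNReal.ofReal (C * D.μ ^ (aexp d - 1 - ((Fintype.card d : ℝ) - 1) / p)) := by
          refine mul_le_mul' le_rfl (((hC₃ (x, l) D.μ hμ).2 p hp hp2).trans (upE hle₃ |>.trans_eq' ?_))
          simp [aexp]
      _ = ENNReal.ofReal (C * (D.σ : ℝ)⁻¹ * D.μ ^ (aexp d - 1 - ((Fintype.card d : ℝ) - 1) / p)) := by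
          rw [← ENNReal.ofReal_mul (inv_pos.2 hσ').le]; ring_nf
  · -- `∂∂P` sup
    intro x i l y
    rw [show D.P x = phiR x D.μ D.σ from rfl, partialDeriv_partialDeriv_phiR x hμ hσ i l y]
    exact ((hC₄ (x, i, l) D.μ hμ).1 (D.σ • y)).trans ((up hle₄).trans_eq' (by simp [aexp]))
  · -- `∂∂P` in `L^p`
    intro x i l p hp hp2
    have e : Torus.partialDeriv i (Torus.partialDeriv l (D.P x)) =
        fun y => Torus.partialDeriv i (Torus.partialDeriv l (phi x D.μ)) (D.σ • y) :=
      funext fun y => partialDeriv_partialDeriv_phiR x hμ hσ i l y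
    rw [e, eLpNorm_comp_nsmul (meas (((isSmooth_phi x hμ).partialDeriv l).partialDeriv i).continuous) hσ]
    exact ((hC₄ (x, i, l) D.μ hμ).2 p hp hp2).trans ((upE hle₄).trans_eq' (by simp [aexp]))
  · -- `∂ΦB` sup
    intro x j l y
    rw [show D.ΦB x j = thetaR x D.μ D.σ j from rfl, partialDeriv_thetaR x hμ hσ l j y, abs_mul,
      abs_of_pos (inv_pos.2 (pow_pos hσ' 2))]
    have h1 := (hC₅ (x, l, j) D.μ hμ).1 (D.σ • y)
    calc ((D.σ : ℝ) ^ 2)⁻¹ * |Torus.partialDeriv l (Torus.partialDeriv j (theta x D.μ)) (D.σ • y)|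
        ≤ ((D.σ : ℝ) ^ 2)⁻¹ * (C * D.μ ^ (aexp d - 2)) := by
          refine mul_le_mul_of_nonneg_left (h1.trans ((up hle₅).trans_eq' ?_)) (inv_pos.2 (pow_pos hσ' 2)).le
          simp [aexp]
      _ = C * ((D.σ : ℝ) ^ 2)⁻¹ * D.μ ^ (aexp d - 2) := by ring
  · -- `∂ΦB` in `L^p`
    intro x j l p hp hp2
    have e : Torus.partialDeriv l (D.ΦB x j) =
        fun y => ((D.σ : ℝ) ^ 2)⁻¹ * Torus.partialDeriv l (Torus.partialDeriv j (theta x D.μ)) (D.σ • y) :=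
      funext fun y => partialDeriv_thetaR x hμ hσ l j y
    rw [e, show (fun y => ((D.σ : ℝ) ^ 2)⁻¹ * Torus.partialDeriv l (Torus.partialDeriv j (theta x D.μ)) (D.σ • y)) =
      ((D.σ : ℝ) ^ 2)⁻¹ • fun y => Torus.partialDeriv l (Torus.partialDeriv j (theta x D.μ)) (D.σ • y) from rfl,
      eLpNorm_const_smul,
      eLpNorm_comp_nsmul (meas (((isSmooth_theta x hμ).partialDeriv j).partialDeriv l).continuous) hσ,
      Real.enorm_eq_ofReal (inv_pos.2 (pow_pos hσ' 2)).le]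
    calc ENNReal.ofReal ((D.σ : ℝ) ^ 2)⁻¹ *
          eLpNorm (Torus.partialDeriv l (Torus.partialDeriv j (theta x D.μ))) (ENNReal.ofReal p) volume
        ≤ ENNReal.ofReal ((D.σ : ℝ) ^ 2)⁻¹ *
            ENNReal.ofReal (C * D.μ ^ (aexp d - 2 - ((Fintype.card d : ℝ) - 1) / p)) := by
          refine mul_le_mul' le_rfl (((hC₅ (x, l, j) D.μ hμ).2 p hp hp2).trans (upE hle₅ |>.trans_eq' ?_))
          simp [aexp]
      _ = ENNReal.ofReal (C * ((D.σ : ℝ) ^ 2)⁻¹ * D.μ ^ (aexp d - 2 - ((Fintype.card d : ℝ) - 1) / p)) := by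
          rw [← ENNReal.ofReal_mul (inv_pos.2 (pow_pos hσ' 2)).le]; ring_nf
  · -- `∂ΦC` in `L²`
    intro x l
    have hB : ∀ y, |psi x D.μ y| ≤ C₁ * D.μ ^ aexp d := fun y => by
      have := (hC₁ x D.μ hμ).1 y; simpa [aexp] using this
    have hF := Torus.isSmooth_invLaplacian (isSmooth_fluct x hμ)
    have e : Torus.partialDeriv l (D.ΦC x) =
        fun y => (D.σ : ℝ)⁻¹ * Torus.partialDeriv l (Torus.invLaplacian (fluct x D.μ)) (D.σ • y) :=
      funext fun y => partialDeriv_oscPot x hμ hσ l y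
    rw [e, show (fun y => (D.σ : ℝ)⁻¹ * Torus.partialDeriv l (Torus.invLaplacian (fluct x D.μ)) (D.σ • y)) =
      (D.σ : ℝ)⁻¹ • fun y => Torus.partialDeriv l (Torus.invLaplacian (fluct x D.μ)) (D.σ • y) from rfl,
      eLpNorm_const_smul, eLpNorm_comp_nsmul (meas (hF.partialDeriv l).continuous) hσ,
      Real.enorm_eq_ofReal (inv_pos.2 hσ').le]
    have hL2 : eLpNorm (Torus.partialDeriv l (Torus.invLaplacian (fluct x D.μ))) 2 volume ≤
        ENNReal.ofReal (C * D.μ ^ aexp d) := by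
      have hint : ∫ y, ‖Torus.partialDeriv l (Torus.invLaplacian (fluct x D.μ)) y‖ ^ 2 ≤
          ((2 * Real.pi)⁻¹) ^ 2 * (C₁ * D.μ ^ aexp d) ^ 2 := by
        have h1 := integral_sq_partialDeriv_invLaplacian_fluct_le hd x hμ hB l
        simpa [Real.norm_eq_abs, sq_abs] using h1
      refine (Torus.eLpNorm_two_le_ofReal_sqrt (hF.partialDeriv l).continuous hint).trans (ENNReal.ofReal_le_ofReal ?_)
      have hprod : 0 ≤ (2 * Real.pi)⁻¹ * (C₁ * D.μ ^ aexp d) := by positivity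
      rw [← mul_pow, Real.sqrt_sq hprod]
      have hπ : (2 * Real.pi)⁻¹ ≤ 1 := by
        rw [inv_le_one_iff₀]; right; linarith [Real.pi_gt_three]
      calc (2 * Real.pi)⁻¹ * (C₁ * D.μ ^ aexp d) ≤ 1 * (C₁ * D.μ ^ aexp d) :=
            mul_le_mul_of_nonneg_right hπ (by positivity)
        _ ≤ C * D.μ ^ aexp d := by rw [one_mul]; exact up hle₁
    calc ENNReal.ofReal (D.σ : ℝ)⁻¹ * eLpNorm (Torus.partialDeriv l (Torus.invLaplacian (fluct x D.μ))) 2 volume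
        ≤ ENNReal.ofReal (D.σ : ℝ)⁻¹ * ENNReal.ofReal (C * D.μ ^ aexp d) := mul_le_mul' le_rfl hL2
      _ = ENNReal.ofReal (C * (D.σ : ℝ)⁻¹ * D.μ ^ aexp d) := by
          rw [← ENNReal.ofReal_mul (inv_pos.2 hσ').le]; ring_nf
  · -- `Δ⁻¹(ψ² - 1)` in `L²`
    intro x
    have hB : ∀ y, |psi x D.μ y| ≤ C₁ * D.μ ^ aexp d := fun y => by
      have := (hC₁ x D.μ hμ).1 y; simpa [aexp] using this
    have h1 := integral_sq_invLaplacian_fluct_le hd x hμ hB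
    have hprod : 0 ≤ (4 * Real.pi ^ 2)⁻¹ * (C₁ * D.μ ^ aexp d) := by positivity
    calc Real.sqrt (∫ y, Torus.invLaplacian (fluct x D.μ) y ^ 2)
        ≤ Real.sqrt (((4 * Real.pi ^ 2)⁻¹) ^ 2 * (C₁ * D.μ ^ aexp d) ^ 2) := Real.sqrt_le_sqrt h1
      _ = (4 * Real.pi ^ 2)⁻¹ * (C₁ * D.μ ^ aexp d) := by rw [← mul_pow, Real.sqrt_sq hprod]
      _ ≤ 1 * (C₁ * D.μ ^ aexp d) := by
          refine mul_le_mul_of_nonneg_right ?_ (by positivity)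
          rw [inv_le_one_iff₀]; right; nlinarith [Real.pi_gt_three]
      _ ≤ C * D.μ ^ aexp d := by rw [one_mul]; exact up hle₁

end BlockConstsExist

/-! ## The time factors -/

section TimeFactors

variable {D} (h : D.Valid) {A : ℝ} (hA : D.DataBounds A)
include h hA

omit h in
/-- `|G_x(t)| ≤ κ^{1/2} A`. [cite: CheskidovLuo2022, §4.2 (4.10)] -/
theorem abs_G_le (x : Index d) (t : ℝ) : |D.G x t| ≤ Real.sqrt D.κ * A :=
  abs_oscProfile_le (hA.g_le x) _ _ _

/-- `∫₀¹ |g_x|^p ≤ A^p` (`p > 0`). [folklore] -/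
theorem intervalIntegral_abs_g_rpow_le (x : Index d) {p : ℝ} (hp : 0 < p) :
    ∫ s in (0 : ℝ)..1, |D.g x s| ^ p ≤ A ^ p := by
  have hc : Continuous fun s => |D.g x s| ^ p := (h.hg x).continuous.abs.rpow_const fun _ => Or.inr hp.le
  calc ∫ s in (0 : ℝ)..1, |D.g x s| ^ p ≤ ∫ _ in (0 : ℝ)..1, A ^ p :=
        intervalIntegral.integral_mono_on zero_le_one (hc.intervalIntegrable _ _) intervalIntegrable_const
          fun s _ => Real.rpow_le_rpow (abs_nonneg _) (hA.g_le x s) hp.le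
    _ = A ^ p := by simp

/-- **`∫₀ᵀ |G_x|^p ≤ (T+1) κ^{p/2-1} A^p`** (`p ≥ 1`; CL22 (4.12)). [cite: CheskidovLuo2022, §4.2 (4.12)] -/
theorem intervalIntegral_abs_G_rpow_le (x : Index d) {p : ℝ} (hp : 1 ≤ p) :
    ∫ t in (0 : ℝ)..D.T, |D.G x t| ^ p ≤ (D.T + 1) * D.κ ^ (p / 2 - 1) * A ^ p := by
  have hp0 : 0 < p := by linarith
  have hκ0 : 0 ≤ D.κ := by linarith [h.hκ]
  refine ((h.hg x).intervalIntegral_abs_oscProfile_rpow_le h.hκ h.hν h.hT.le hp0).trans ?_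
  exact mul_le_mul_of_nonneg_left (intervalIntegral_abs_g_rpow_le h hA x hp0)
    (mul_nonneg (by linarith [h.hT]) (Real.rpow_nonneg hκ0 _))

/-- **`∫₀ᵀ |G_x| ≤ (T+1) κ^{-1/2} A`** (CL22 (4.12), `p = 1`). [cite: CheskidovLuo2022, §4.2 (4.12)] -/
theorem intervalIntegral_abs_G_le (x : Index d) :
    ∫ t in (0 : ℝ)..D.T, |D.G x t| ≤ (D.T + 1) * D.κ ^ (-(1 / 2 : ℝ)) * A := by
  have h1 := intervalIntegral_abs_G_rpow_le h hA x le_rfl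
  simp only [Real.rpow_one] at h1
  convert h1 using 2; norm_num

omit [DecidableEq d] hA in
/-- **`∫₀ᵀ G_x² ≤ T + 1`** (unit energy per period, CL22 (4.9)). [cite: CheskidovLuo2022, §4.2 (4.9)] -/
theorem intervalIntegral_G_sq_le (x : Index d) : ∫ t in (0 : ℝ)..D.T, D.G x t ^ 2 ≤ D.T + 1 := by
  have h1 := (h.hg x).intervalIntegral_abs_oscProfile_rpow_le h.hκ h.hν h.hT.le (p := 2) two_pos
  have e1 : ∫ t in (0 : ℝ)..D.T, |oscProfile D.ν D.κ (D.g x) t| ^ (2 : ℝ) = ∫ t in (0 : ℝ)..D.T, D.G x t ^ 2 :=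
    intervalIntegral.integral_congr fun t _ => by
      show |D.G x t| ^ (2 : ℝ) = D.G x t ^ 2
      rw [Real.rpow_two, sq_abs]
  have e2 : ∫ s in (0 : ℝ)..1, |D.g x s| ^ (2 : ℝ) = 1 :=
    (intervalIntegral.integral_congr fun s _ => by
      show |D.g x s| ^ (2 : ℝ) = D.g x s ^ 2
      rw [Real.rpow_two, sq_abs]).trans (h.hg1 x)
  rw [e1, e2] at h1
  simpa using h1

/-- **`∫₀ᵀ |G_x'| ≤ (T+1) ν κ^{1/2} A`** (`G_x' = νκ (g_x')_κ(ν·)`, CL22 Lemma 5.2 with `n = 1`,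
`p = 1`). [cite: CheskidovLuo2022, §5.2 Lemma 5.2] -/
theorem intervalIntegral_abs_dG_le (x : Index d) :
    ∫ t in (0 : ℝ)..D.T, |D.dG x t| ≤ (D.T + 1) * D.ν * D.κ ^ (1 / 2 : ℝ) * A := by
  have hν0 : 0 ≤ D.ν := by linarith [h.hν]
  have hκ0 : 0 < D.κ := by linarith [h.hκ]
  have hb := (h.hg x).deriv
  have h1 := hb.intervalIntegral_abs_oscProfile_rpow_le h.hκ h.hν h.hT.le (p := 1) one_pos
  simp only [Real.rpow_one] at h1
  have h2 : ∫ s in (0 : ℝ)..1, |deriv (D.g x) s| ≤ A := by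
    have h3 : ∫ s in (0 : ℝ)..1, |deriv (D.g x) s| ≤ ∫ _ in (0 : ℝ)..1, A :=
      intervalIntegral.integral_mono_on zero_le_one (hb.continuous.abs.intervalIntegrable _ _)
        intervalIntegrable_const fun s _ => hA.dg_le x s
    simpa using h3
  have e : ∀ t, |D.dG x t| = D.ν * D.κ * |oscProfile D.ν D.κ (deriv (D.g x)) t| := by
    intro t; rw [Datum.dG, abs_mul, abs_mul, abs_of_nonneg hν0, abs_of_pos hκ0]
  simp_rw [e]
  rw [intervalIntegral.integral_const_mul]
  calc D.ν * D.κ * ∫ t in (0 : ℝ)..D.T, |oscProfile D.ν D.κ (deriv (D.g x)) t|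
      ≤ D.ν * D.κ * ((D.T + 1) * D.κ ^ ((1 : ℝ) / 2 - 1) * A) := by
        refine mul_le_mul_of_nonneg_left (h1.trans ?_) (by positivity)
        exact mul_le_mul_of_nonneg_left h2 (mul_nonneg (by linarith [h.hT]) (Real.rpow_nonneg hκ0.le _))
    _ = (D.T + 1) * D.ν * D.κ ^ (1 / 2 : ℝ) * A := by
        have : D.κ * D.κ ^ ((1 : ℝ) / 2 - 1) = D.κ ^ (1 / 2 : ℝ) := by
          rw [← Real.rpow_one_add' hκ0.le (by norm_num)]; norm_num
        calc D.ν * D.κ * ((D.T + 1) * D.κ ^ ((1 : ℝ) / 2 - 1) * A)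
            = (D.T + 1) * D.ν * (D.κ * D.κ ^ ((1 : ℝ) / 2 - 1)) * A := by ring
          _ = _ := by rw [this]

omit [DecidableEq d] hA in
/-- **`|H_x(t)| ≤ ν⁻¹`** (CL22 (4.11): `‖h_κ‖_∞ ≤ 1`). [cite: CheskidovLuo2022, §4.2 (4.11)] -/
theorem abs_H_le (x : Index d) (t : ℝ) : |D.H x t| ≤ D.ν⁻¹ :=
  (h.hg x).abs_oscPrim_le h.hκ (h.hg1 x) (by linarith [h.hν]) t

omit [DecidableEq d] hA in
/-- `G_x` is continuous on `[0, T]`. [folklore] -/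
theorem continuousOn_G (x : Index d) : ContinuousOn (D.G x) (Icc 0 D.T) :=
  (contDiff_G h x).continuous.continuousOn

omit [DecidableEq d] hA in
/-- `G_x'` is continuous on `[0, T]`. [folklore] -/
theorem continuousOn_dG (x : Index d) : ContinuousOn (D.dG x) (Icc 0 D.T) :=
  (contDiff_dG h x).continuous.continuousOn

omit [DecidableEq d] hA in
/-- `|G_x(t)| |G_{x'}(t)| = 0` for `x ≠ x'` (one direction at a time). [folklore] -/
theorem abs_G_mul_abs_G {x x' : Index d} (hxx' : x ≠ x') (t : ℝ) : |D.G x t| * |D.G x' t| = 0 := by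
  rw [← abs_mul, G_mul_G h hxx', abs_zero]

end TimeFactors

end Datum

end CL22

end Literature.Analysis.FluidPDE
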